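import Literature.MathematicalPhysics.QuantumManyBody.PeriodicBoseGasFourier
import Literature.MathematicalPhysics.QuantumManyBody.WeightedCorrector
import Mathlib.Analysis.SpecialFunctions.ExpDeriv
import Mathlib.MeasureTheory.Integral.Prod
import HarnessLib

/-!
# One-body density and current of an `N`-body function, configuration-space phase unitaries,
# and the phase-unwinding gain functional

Topic `Literature/MathematicalPhysics/QuantumManyBody` (definition item `defn-CoarseModeRayPOVM`,
second half: the *record-conditional one-body densities* and the *`n`-weighted Helmholtz (gain)
functional* wanted by route `BECIroning` of `AtomisticToContinuum/BoseEinsteinCondensation`, items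
`IroningLink` / `IroningCost`). Companion of `PeriodicBoseGas.lean` (`cell`, `cellN`,
`kineticDensity`, `periodicInteraction`, `PeriodicTrialState`, `periodicEnergy`),
`WeightedCorrector.lean` (`integrableOn_cellN`; the `H₋₁` supremum `hMinusOneSqW` there is the
`N`-body analogue of `maxPhaseGain`) and `CoarseModeRayPOVM.lean` (the Kraus map `K_z`; the route
applies the objects below to the unnormalised conditional states `Φ = K_z Ψ`, e.g.
`maxPhaseGain L N (coarseModeRayPOVM L S z Ψ.ψ)`; the two files do not import each other).

**Setting.** `N` particles on the torus `(ℝ³/Lℤ³)^N`, fundamental cell `cellN N L = [0,L)^{3N}`,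
`H = ∑ⱼ -Δⱼ + ∑_{i<j} v^per(xᵢ - xⱼ)` in the units `ħ = 2m = 1` of the tree. For a real one-body
phase `θ` the configuration-space unitary `(U_θΦ)(X) = e^{-i∑ⱼθ(xⱼ)}Φ(X)` — LSSY's gauge
transformation `e^{iφ(∑ᵢzᵢ)/L}` [LSSY2005, §5.2 (5.23)] for the linear phase of an imposed velocity
field, under which `p ↦ p - mv` (5.19) — satisfies `|U_θΦ| = |Φ|` and
`U_θ^* (∑ⱼ -Δⱼ) U_θ = ∑ⱼ (pⱼ - ∇θ(xⱼ))²`, whence the **gain identity**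
`T(U_θΦ) = T(Φ) - 2∫_{cell} ∇θ·j_Φ + ∫_{cell} |∇θ|² n_Φ`
with the one-body density `n_Φ` and current `j_Φ` of `Φ`; the interaction is unchanged. The
**gain** `GAIN(θ; Φ) = 2∫∇θ·j_Φ - ∫|∇θ|²n_Φ` is the kinetic energy removed by unwinding the phase
`θ`, and `GAIN*(Φ) = sup_θ GAIN(θ; Φ)` (over `C¹` periodic `θ`) is formally `∫|P_∇ j_Φ|²/n_Φ`, the
`n_Φ`-weighted `Ḣ⁻¹` norm of the current (Helmholtz projection onto periodic gradients).

## Main definitions (namespace `Literature.MathematicalPhysics.QuantumManyBody.BoseGas`)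

* `periodicForm v L Φ = ⟨Φ, HΦ⟩` on the cell for an *unnormalised* `Φ` (the integrand of
  `periodicEnergy`; `periodicEnergy_eq_periodicForm` is `rfl`); `kineticDensityReal`,
  `cellKineticEnergy L Φ = T_L(Φ) = ∫_{cell} |∇Φ|²` (real Bochner; `lintegral_kineticDensity_eq`
  identifies it with the `ℝ≥0∞` kinetic term for `C¹` data).
* `particleCurrent i k Φ X = Im(conj Φ(X) ∂_{i,k}Φ(X))`;
  `oneBodyDensity L N Φ x = n_Φ(x) = ∑ᵢ ∫_{cell^{N-1}} |Φ(X; xᵢ = x)|² dX̂ᵢ`,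
  `oneBodyCurrent L N Φ k x = j_Φ(x)_k = ∑ᵢ ∫_{cell^{N-1}} Im(conj Φ ∂_{i,k}Φ)(X; xᵢ = x) dX̂ᵢ`
  (real Bochner integrals over `cellN (N-1) L`, the slot filled by `Fin.insertNth`; `0` for `N = 0`).
* `phaseMul θ Φ = U_θΦ`; `PeriodicTrialState.phaseMul` — the unwound admissible state `U_θΨ`.
* `phaseGain L N Φ θ = GAIN(θ; Φ)`; `IsPeriodicPhase L θ` (`C¹`, `Lℤ³`-periodic);
  `maxPhaseGain L N Φ = GAIN*(Φ) = ⨆_{θ admissible} ENNReal.ofReal (GAIN(θ; Φ)) ∈ [0, ∞]`.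

## API (all proved)

* `norm_phaseMul`/`nnnorm_phaseMul` (`|U_θΦ| = |Φ|`), `contDiff_phaseMul`, `phaseMul_periodic`,
  `phaseMul_symm`, `phaseMul_zero`;
* `fderiv_phaseMul_apply_single`: `∂_{i,k}(U_θΦ) = e^{-iΘ}(∂_{i,k}Φ - i∂ₖθ(xᵢ)Φ)`;
  `kineticDensityReal_phaseMul`: the pointwise identity
  `|∇(U_θΦ)|² = |∇Φ|² - 2∑ᵢ∇θ(xᵢ)·Jᵢ + ∑ᵢ|∇θ(xᵢ)|²|Φ|²`;
* Fubini on the cell: `measurePreserving_piFinSuccAbove_cellN`,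
  `integral_cellN_mul_eq_integral_marginal` (`∫_{cell^{n+1}} g(xᵢ)F(X) = ∫_{cell} g (∫ F(X; xᵢ=x))`),
  `integrableOn_mul_marginal`; hence `integral_sum_fderiv_mul_particleCurrent`,
  `integral_sum_fderiv_sq_mul_norm_sq` (configuration-space pairings `=` one-body pairings);
* **`cellKineticEnergy_phaseMul`: `T_L(U_θΦ) = T_L(Φ) - GAIN(θ; Φ)`** for `θ, Φ ∈ C¹`;
  `phaseGain_eq_sub`, `phaseGain_le_cellKineticEnergy`, `periodicForm_phaseMul`
  (`⟨U_θΦ, HU_θΦ⟩ = (T_L(Φ) - GAIN) + interaction of Φ`);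
* `le_maxPhaseGain` (variational lower bound), `maxPhaseGain_le_ofReal_iff`, `phaseGain_const`
  (`= 0`, so `GAIN* ≥ 0` is not vacuous), `maxPhaseGain_le_cellKineticEnergy` (`GAIN* ≤ T < ∞`);
  closure properties of `IsPeriodicPhase`.

## Design choices

* **Sum over slots, not `N ×` first slot.** `n_Φ` and `j_Φ` are defined as `∑ᵢ` of the `i`-th
  marginals, the one-body density/current of an arbitrary `N`-body function; for Bose-symmetric `Φ`
  this is the textbook `N ∫ |Φ(x, X')|² dX'` (resp. `N ∫ Im(conj Φ ∇₁Φ)`), cf. `oneParticleDensity`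
  of `OneParticleMarginals.lean` (whole space, `ℝ≥0∞`, first slot). The symmetric-sum form is what
  the gain identity produces term by term (`∑ⱼ (pⱼ - ∇θ(xⱼ))²`), so the identity holds with no
  symmetry hypothesis; `K_zΨ` is symmetric anyway.
* **Real Bochner integrals** for `n`, `j`, `GAIN` (the current and the gain are signed); `ℝ≥0∞` for
  `GAIN*`, a supremum truncated termwise at `0` by `ENNReal.ofReal` exactly as `hMinusOneSqW`
  (harmless: constants give `0`). Gradients of `θ` enter through the coordinates
  `∂ₖθ = fderiv ℝ θ x (EuclideanSpace.single k 1)`, matching `kineticDensity`/`gradSq`.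
* **Admissible phases are strictly periodic** `C¹` functions (the requester's class): `U_θ` then
  preserves `PeriodicTrialState` (`PeriodicTrialState.phaseMul`). Winding phases `θ = 2πn·x/L`
  (Galilean boosts, LSSY's twisted boundary conditions (5.24)) are *not* included.
* Hypotheses are unbundled and minimal: pointwise lemmas ask differentiability at the point, the
  integrated identity asks `θ, Φ ∈ C¹` (continuity of all integrands on the bounded cell gives
  integrability, `integrableOn_cellN`).
* Deliberately not here: the Euler–Lagrange/Helmholtz characterisation `GAIN* = ∫|P_∇j|²/n`
  (existence of the optimal `θ` needs `n_Φ > 0` and an elliptic solve), the Kipnis–Varadhan form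
  `GAIN* ≤ C ⇔ (∫∇θ·j)² ≤ C∫|∇θ|²n` (routine from `maxPhaseGain_le_ofReal_iff` by scaling `θ ↦ tθ`,
  cf. `hMinusOneSqW_le_ofReal_iff`), continuity equations, and anything about ground states.
* Mathlib has no one-body densities, probability currents or gauge transformations (searched
  `probabilityCurrent`, `oneBodyDensity`, `gauge`); `fderiv`, `Fin.insertNth`,
  `MeasurableEquiv.piFinSuccAbove`, `integral_prod`, `Complex.exp` are Mathlib's.

## References

* [LSSY2005] E. H. Lieb, R. Seiringer, J. P. Solovej, J. Yngvason, *The Mathematics of the Bose Gas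
  and its Condensation*, Birkhäuser 2005: §1.2 (1.16)–(1.18) (kinetic energy, one-particle density
  matrix), §5.2 (5.18)–(5.24) (velocity field `p ↦ p - mv`, the gauge transformation
  `(UΨ) = e^{iφ∑zᵢ/L}Ψ`, twisted boundary conditions).
* [Fournais2020] S. Fournais, *Length scales for BEC in the dilute Bose gas*, arXiv:2011.00309:
  (1.1) (the periodic Hamiltonian and its quadratic form).
-/

noncomputable section

open MeasureTheory Metric
open scoped ENNReal NNReal ComplexConjugate

namespace Literature.MathematicalPhysics.QuantumManyBody.BoseGas

variable {N : ℕ}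

/-! ### The form of `H` and the kinetic energy of an unnormalised periodic function -/

/-- The quadratic form `⟨Φ, HΦ⟩ = ∫_{[0,L)^{3N}} (|∇Φ|² + ∑_{i<j} v^per(xᵢ - xⱼ)|Φ|²) dX ∈ [0, ∞]` of
the periodic `N`-body Hamiltonian `H = ∑ⱼ -Δⱼ + ∑_{i<j} v^per(xᵢ - xⱼ)` (units `ħ = 2m = 1`) on an
*unnormalised* function `Φ` — the integrand of `periodicEnergy`, which is its restriction to
normalised admissible states (`periodicEnergy_eq_periodicForm`); needed for conditional
(post-measurement) states `K_z Ψ`, which are not normalised. [cite: Fournais2020, (1.1)] -/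
def periodicForm (v : ℝ → ℝ≥0∞) (L : ℝ) (Φ : Config N → ℂ) : ℝ≥0∞ :=
  ∫⁻ X in cellN N L, kineticDensity Φ X + periodicInteraction v L X * (‖Φ X‖₊ : ℝ≥0∞) ^ 2

/-- `periodicEnergy v Ψ = periodicForm v L Ψ.ψ` (`rfl`). [cite: Fournais2020, (1.1)] -/
theorem periodicEnergy_eq_periodicForm {L : ℝ} (v : ℝ → ℝ≥0∞) (Ψ : PeriodicTrialState N L) :
    periodicEnergy v Ψ = periodicForm v L Ψ.ψ := rfl

/-- The kinetic energy density as a real number: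
`|∇Φ(X)|² = ∑ᵢ ∑ₖ |∂Φ/∂x_{i,k}(X)|²` (`kineticDensity` is its `ℝ≥0∞` cast,
`kineticDensity_eq_ofReal`). [cite: LSSY2005, §1.2 (1.16)] -/
def kineticDensityReal (Φ : Config N → ℂ) (X : Config N) : ℝ :=
  ∑ i : Fin N, ∑ k : Fin 3, ‖fderiv ℝ Φ X (Pi.single i (EuclideanSpace.single k 1))‖ ^ 2

/-- The kinetic energy `T_L(Φ) = ∫_{[0,L)^{3N}} |∇Φ|² dX` of an `N`-body function on the fundamental
cell, as a real Bochner integral (finite and equal to the `ℝ≥0∞` kinetic term of `periodicForm`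
for `C¹` data, `lintegral_kineticDensity_eq`). [cite: LSSY2005, §1.2 (1.16)] -/
def cellKineticEnergy (L : ℝ) (Φ : Config N → ℂ) : ℝ :=
  ∫ X in cellN N L, kineticDensityReal Φ X

/-- `|∇Φ(X)|² ≥ 0`. [folklore] -/
theorem kineticDensityReal_nonneg (Φ : Config N → ℂ) (X : Config N) : 0 ≤ kineticDensityReal Φ X :=
  Finset.sum_nonneg fun _ _ => Finset.sum_nonneg fun _ _ => sq_nonneg _

/-- `kineticDensity Φ X = ENNReal.ofReal (kineticDensityReal Φ X)`. [folklore] -/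
theorem kineticDensity_eq_ofReal (Φ : Config N → ℂ) (X : Config N) :
    kineticDensity Φ X = ENNReal.ofReal (kineticDensityReal Φ X) := by
  unfold kineticDensity kineticDensityReal
  rw [ENNReal.ofReal_sum_of_nonneg (fun i _ => Finset.sum_nonneg fun k _ => sq_nonneg _)]
  refine Finset.sum_congr rfl fun i _ => ?_
  rw [ENNReal.ofReal_sum_of_nonneg (fun k _ => sq_nonneg _)]
  refine Finset.sum_congr rfl fun k _ => ?_
  exact coe_nnnorm_sq_eq_ofReal _

/-- `X ↦ |∇Φ(X)|²` is continuous for `Φ ∈ C¹`. [folklore] -/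
theorem continuous_kineticDensityReal {Φ : Config N → ℂ} (hΦ : ContDiff ℝ 1 Φ) :
    Continuous (kineticDensityReal Φ) := by
  unfold kineticDensityReal
  have hc := hΦ.continuous_fderiv one_ne_zero
  fun_prop

/-- For `Φ ∈ C¹` the `ℝ≥0∞` kinetic term on the cell is the real kinetic energy:
`∫⁻_{cell} kineticDensity Φ = ENNReal.ofReal (T_L(Φ))`. [folklore] -/
theorem lintegral_kineticDensity_eq {Φ : Config N → ℂ} (hΦ : ContDiff ℝ 1 Φ) (L : ℝ) :
    ∫⁻ X in cellN N L, kineticDensity Φ X = ENNReal.ofReal (cellKineticEnergy L Φ) := by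
  simp only [kineticDensity_eq_ofReal]
  rw [cellKineticEnergy, ofReal_integral_eq_lintegral_ofReal]
  · exact integrableOn_cellN (continuous_kineticDensityReal hΦ) L
  · exact Filter.Eventually.of_forall fun X => kineticDensityReal_nonneg Φ X

/-- `T_L(Φ) ≥ 0`. [folklore] -/
theorem cellKineticEnergy_nonneg (L : ℝ) (Φ : Config N → ℂ) : 0 ≤ cellKineticEnergy L Φ :=
  integral_nonneg fun X => kineticDensityReal_nonneg Φ X

/-! ### One-body density and current -/

/-- The current density of particle `i` along axis `k` at the configuration `X`:
`J_{i,k}(X) = Im(conj(Φ(X)) ∂Φ/∂x_{i,k}(X))` (units `ħ = 2m = 1`, in which the kinetic form of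
`e^{-i∑θ(xⱼ)}Φ` is `∫|∇Φ|² - 2∫∇θ·j + ∫|∇θ|²n`). [folklore] -/
def particleCurrent (i : Fin N) (k : Fin 3) (Φ : Config N → ℂ) (X : Config N) : ℝ :=
  (conj (Φ X) * fderiv ℝ Φ X (Pi.single i (EuclideanSpace.single k 1))).im

/-- **The one-body density** `n_Φ(x) = ∑ᵢ ∫_{[0,L)^{3(N-1)}} |Φ(x₁,…,xᵢ = x,…,x_N)|² ∏_{j≠i} dxⱼ` of an
(unnormalised) `N`-body function on the torus of side `L`: the diagonal of the one-particle density
matrix, `= N ∫ |Φ(x, X')|² dX'` for Bose-symmetric `Φ`; `∫_{cell} n_Φ = N‖Φ‖²`. Real-valued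
(Bochner; the `i`-th slot is filled by `Fin.insertNth`); `0` for `N = 0`. [cite: LSSY2005, §1.2 (1.17)–(1.18)] -/
def oneBodyDensity (L : ℝ) : (N : ℕ) → (Config N → ℂ) → Space → ℝ
  | 0, _, _ => 0
  | n + 1, Φ, x => ∑ i : Fin (n + 1), ∫ Y in cellN n L, ‖Φ (i.insertNth x Y)‖ ^ 2

/-- **The one-body current** `j_Φ(x)_k = ∑ᵢ ∫_{[0,L)^{3(N-1)}} Im(conj(Φ) ∂_{i,k}Φ)(…, xᵢ = x, …) ∏_{j≠i} dxⱼ`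
(`k = 1,2,3`) of an (unnormalised) `N`-body function: `= N ∫ Im(conj Φ ∇₁Φ)(x, X') dX'` for
Bose-symmetric `Φ`; it is the linear response of the kinetic energy to a configuration-space
phase, `T(e^{-i∑θ(xⱼ)}Φ) = T(Φ) - 2∫∇θ·j_Φ + ∫|∇θ|²n_Φ` (`cellKineticEnergy_phaseMul`).
[folklore] -/
def oneBodyCurrent (L : ℝ) : (N : ℕ) → (Config N → ℂ) → Fin 3 → Space → ℝ
  | 0, _, _, _ => 0
  | n + 1, Φ, k, x => ∑ i : Fin (n + 1), ∫ Y in cellN n L, particleCurrent i k Φ (i.insertNth x Y)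

/-- `n_Φ ≥ 0`. [folklore] -/
theorem oneBodyDensity_nonneg (L : ℝ) : ∀ (N : ℕ) (Φ : Config N → ℂ) (x : Space),
    0 ≤ oneBodyDensity L N Φ x
  | 0, _, _ => le_rfl
  | _ + 1, _, _ => Finset.sum_nonneg fun _ _ => integral_nonneg fun _ => sq_nonneg _

/-! ### Configuration-space phase unitaries -/

/-- **The configuration-space phase unitary** `(U_θ Φ)(X) = e^{-i ∑ⱼ θ(xⱼ)} Φ(X)` of a real one-body
phase function `θ` (LSSY's gauge transformation `e^{iφ(∑ᵢzᵢ)/L}` for the linear phase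
`θ(x) = -φ z/L`): `|U_θΦ| = |Φ|`, so densities and the interaction are unchanged, while
`U_θ^* (-Δⱼ) U_θ = (pⱼ - ∇θ(xⱼ))²`. [cite: LSSY2005, §5.2 (5.19)–(5.23)] -/
def phaseMul (θ : Space → ℝ) (Φ : Config N → ℂ) (X : Config N) : ℂ :=
  Complex.exp (((-∑ j, θ (X j) : ℝ) : ℂ) * Complex.I) * Φ X

/-- `|U_θΦ(X)| = |Φ(X)|`. [cite: LSSY2005, §5.2 (5.23)] -/
theorem norm_phaseMul (θ : Space → ℝ) (Φ : Config N → ℂ) (X : Config N) :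
    ‖phaseMul θ Φ X‖ = ‖Φ X‖ := by
  rw [phaseMul, norm_mul, Complex.norm_exp_ofReal_mul_I, one_mul]

/-- `‖U_θΦ(X)‖₊ = ‖Φ(X)‖₊`. [cite: LSSY2005, §5.2 (5.23)] -/
theorem nnnorm_phaseMul (θ : Space → ℝ) (Φ : Config N → ℂ) (X : Config N) :
    ‖phaseMul θ Φ X‖₊ = ‖Φ X‖₊ :=
  NNReal.eq (norm_phaseMul θ Φ X)

/-- `U_0 = 𝟙`. [folklore] -/
@[simp]
theorem phaseMul_zero (Φ : Config N → ℂ) : phaseMul (fun _ => (0 : ℝ)) Φ = Φ := by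
  funext X
  simp [phaseMul]

/-- `U_θ` preserves per-particle periodicity when `θ` is `Lℤ³`-periodic. [folklore] -/
theorem phaseMul_periodic {L : ℝ} {θ : Space → ℝ} (hθ : ∀ (x : Space) (k : Fin 3),
    θ (x + EuclideanSpace.single k L) = θ x) {Φ : Config N → ℂ}
    (hΦ : ∀ (X : Config N) (i : Fin N) (k : Fin 3), Φ (X + Pi.single i (EuclideanSpace.single k L)) = Φ X)
    (X : Config N) (i : Fin N) (k : Fin 3) :
    phaseMul θ Φ (X + Pi.single i (EuclideanSpace.single k L)) = phaseMul θ Φ X := by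
  have hsum : ∑ j, θ ((X + Pi.single i (EuclideanSpace.single k L) : Config N) j) = ∑ j, θ (X j) := by
    refine Finset.sum_congr rfl fun j _ => ?_
    rcases eq_or_ne j i with rfl | hj
    · simp [hθ]
    · simp [hj]
  rw [phaseMul, phaseMul, hsum, hΦ]

/-- `U_θ` preserves Bose symmetry. [folklore] -/
theorem phaseMul_symm (θ : Space → ℝ) {Φ : Config N → ℂ}
    (hΦ : ∀ (σ : Equiv.Perm (Fin N)) (X : Config N), Φ (X ∘ σ) = Φ X)
    (σ : Equiv.Perm (Fin N)) (X : Config N) : phaseMul θ Φ (X ∘ σ) = phaseMul θ Φ X := by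
  have hsum : ∑ j, θ ((X ∘ σ) j) = ∑ j, θ (X j) := Equiv.sum_comp σ (fun j => θ (X j))
  rw [phaseMul, phaseMul, hsum, hΦ]

/-- `U_θΦ ∈ C¹` for `θ, Φ ∈ C¹`. [folklore] -/
theorem contDiff_phaseMul {θ : Space → ℝ} (hθ : ContDiff ℝ 1 θ) {Φ : Config N → ℂ}
    (hΦ : ContDiff ℝ 1 Φ) : ContDiff ℝ 1 (phaseMul θ Φ) := by
  unfold phaseMul
  have h1 : ContDiff ℝ 1 fun X : Config N => ∑ j, θ (X j) :=
    ContDiff.sum fun j _ => hθ.comp (contDiff_apply ℝ Space j)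
  have h2 : ContDiff ℝ 1 fun X : Config N => ((-∑ j, θ (X j) : ℝ) : ℂ) :=
    Complex.ofRealCLM.contDiff.comp h1.neg
  exact (Complex.contDiff_exp.comp (h2.mul contDiff_const)).mul hΦ

/-- **The unwound state** `U_θΨ` of an admissible periodic state is admissible (same norm, `C¹`,
periodic, symmetric) for an `Lℤ³`-periodic `C¹` phase `θ`. [cite: LSSY2005, §5.2 (5.23)–(5.24)] -/
def PeriodicTrialState.phaseMul {L : ℝ} (Ψ : PeriodicTrialState N L) {θ : Space → ℝ}
    (hθ : ContDiff ℝ 1 θ) (hper : ∀ (x : Space) (k : Fin 3), θ (x + EuclideanSpace.single k L) = θ x) :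
    PeriodicTrialState N L where
  ψ := BoseGas.phaseMul θ Ψ.ψ
  contDiff := contDiff_phaseMul hθ Ψ.contDiff
  periodic := phaseMul_periodic hper Ψ.periodic
  symm := phaseMul_symm θ Ψ.symm
  norm_eq := by
    have h := Ψ.norm_eq
    simp_rw [nnnorm_phaseMul]
    exact h

/-- Unfolding `(U_θΨ).ψ = e^{-i∑θ(xⱼ)} Ψ`. [folklore] -/
@[simp]
theorem PeriodicTrialState.phaseMul_ψ {L : ℝ} (Ψ : PeriodicTrialState N L) {θ : Space → ℝ}
    (hθ : ContDiff ℝ 1 θ) (hper : ∀ (x : Space) (k : Fin 3), θ (x + EuclideanSpace.single k L) = θ x) :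
    (Ψ.phaseMul hθ hper).ψ = BoseGas.phaseMul θ Ψ.ψ := rfl

/-! ### The derivative of `U_θΦ` and the pointwise gain identity -/

/-- `|a - i b Φ|² = |a|² - 2b Im(conj(Φ) a) + b²|Φ|²` for real `b` (the algebra behind the gain
identity). [folklore] -/
theorem norm_sub_I_mul_sq (a Φ : ℂ) (b : ℝ) :
    ‖a - Complex.I * b * Φ‖ ^ 2 = ‖a‖ ^ 2 - 2 * b * (conj Φ * a).im + b ^ 2 * ‖Φ‖ ^ 2 := by
  rw [← Complex.normSq_eq_norm_sq, ← Complex.normSq_eq_norm_sq, ← Complex.normSq_eq_norm_sq]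
  simp only [Complex.normSq_apply, Complex.sub_re, Complex.sub_im, Complex.mul_re, Complex.mul_im,
    Complex.I_re, Complex.I_im, Complex.ofReal_re, Complex.ofReal_im, Complex.conj_re,
    Complex.conj_im]
  ring

/-- The phase sum `Θ(X) = ∑ⱼ θ(xⱼ)` has derivative `∑ⱼ dθ(xⱼ) ∘ πⱼ`. [folklore] -/
theorem hasFDerivAt_phaseSum {θ : Space → ℝ} (hθ : Differentiable ℝ θ) (X : Config N) :
    HasFDerivAt (fun Y : Config N => ∑ j, θ (Y j))
      (∑ j, (fderiv ℝ θ (X j)).comp (ContinuousLinearMap.proj j)) X :=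
  HasFDerivAt.fun_sum fun j _ => (hθ (X j)).hasFDerivAt.comp X (hasFDerivAt_apply j X)

/-- **The derivative of the unwound function along `e_{i,k}`**:
`∂_{i,k}(U_θΦ)(X) = e^{-iΘ(X)} (∂_{i,k}Φ(X) - i ∂ₖθ(xᵢ) Φ(X))`. [folklore] -/
theorem fderiv_phaseMul_apply_single {θ : Space → ℝ} (hθ : Differentiable ℝ θ) {Φ : Config N → ℂ}
    {X : Config N} (hΦ : DifferentiableAt ℝ Φ X) (i : Fin N) (k : Fin 3) :
    fderiv ℝ (phaseMul θ Φ) X (Pi.single i (EuclideanSpace.single k 1)) =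
      Complex.exp (((-∑ j, θ (X j) : ℝ) : ℂ) * Complex.I) *
        (fderiv ℝ Φ X (Pi.single i (EuclideanSpace.single k 1)) -
          Complex.I * (fderiv ℝ θ (X i) (EuclideanSpace.single k 1) : ℝ) * Φ X) := by
  -- the phase factor `E(Y) = exp(g(Y))`, `g(Y) = (-(Θ Y) : ℂ) * I`
  set Θ' : Config N →L[ℝ] ℝ := ∑ j, (fderiv ℝ θ (X j)).comp (ContinuousLinearMap.proj j) with hΘ'
  have hΘ : HasFDerivAt (fun Y : Config N => -∑ j, θ (Y j)) (-Θ') X :=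
    (hasFDerivAt_phaseSum hθ X).neg
  have hg : HasFDerivAt (fun Y : Config N => ((-∑ j, θ (Y j) : ℝ) : ℂ) * Complex.I)
      (Complex.I • Complex.ofRealCLM.comp (-Θ')) X :=
    (Complex.ofRealCLM.hasFDerivAt.comp X hΘ).mul_const Complex.I
  have hE : HasFDerivAt (fun Y : Config N => Complex.exp (((-∑ j, θ (Y j) : ℝ) : ℂ) * Complex.I))
      (Complex.exp (((-∑ j, θ (X j) : ℝ) : ℂ) * Complex.I) •
        (Complex.I • Complex.ofRealCLM.comp (-Θ'))) X := hg.cexp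
  have hprod := hE.mul hΦ.hasFDerivAt
  rw [show phaseMul θ Φ = (fun Y => Complex.exp (((-∑ j, θ (Y j) : ℝ) : ℂ) * Complex.I)) * Φ
    from rfl, hprod.fderiv]
  have hΘ'v : Θ' (Pi.single i (EuclideanSpace.single k 1)) =
      fderiv ℝ θ (X i) (EuclideanSpace.single k 1) := by
    rw [hΘ', sum_apply, Finset.sum_eq_single i]
    · simp
    · intro j _ hj
      simp [hj]
    · simp
  simp only [add_apply, smul_apply, smul_eq_mul, ContinuousLinearMap.comp_apply, neg_apply,
    Complex.ofRealCLM_apply, hΘ'v, Complex.ofReal_neg]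
  ring

/-- **The pointwise gain identity**: for a differentiable real phase `θ` and `Φ` differentiable at
`X`, `|∇(U_θΦ)(X)|² = |∇Φ(X)|² - 2 ∑ᵢ ∇θ(xᵢ)·J_i(X) + ∑ᵢ |∇θ(xᵢ)|² |Φ(X)|²`, where
`J_{i}(X) = Im(conj Φ ∇ᵢΦ)(X)` (`particleCurrent`): the kinetic energy density of the gauge-transformed
function, `U_θ^*(-Δⱼ)U_θ = (pⱼ - ∇θ(xⱼ))²`. [cite: LSSY2005, §5.2 (5.19)–(5.23)] -/
theorem kineticDensityReal_phaseMul {θ : Space → ℝ} (hθ : Differentiable ℝ θ) {Φ : Config N → ℂ}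
    {X : Config N} (hΦ : DifferentiableAt ℝ Φ X) :
    kineticDensityReal (phaseMul θ Φ) X =
      kineticDensityReal Φ X -
        2 * ∑ i : Fin N, ∑ k : Fin 3,
          fderiv ℝ θ (X i) (EuclideanSpace.single k 1) * particleCurrent i k Φ X +
        ∑ i : Fin N, ∑ k : Fin 3, fderiv ℝ θ (X i) (EuclideanSpace.single k 1) ^ 2 * ‖Φ X‖ ^ 2 := by
  have hik : ∀ (i : Fin N) (k : Fin 3),
      ‖fderiv ℝ (phaseMul θ Φ) X (Pi.single i (EuclideanSpace.single k 1))‖ ^ 2 =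
        ‖fderiv ℝ Φ X (Pi.single i (EuclideanSpace.single k 1))‖ ^ 2 -
          2 * (fderiv ℝ θ (X i) (EuclideanSpace.single k 1) * particleCurrent i k Φ X) +
          fderiv ℝ θ (X i) (EuclideanSpace.single k 1) ^ 2 * ‖Φ X‖ ^ 2 := by
    intro i k
    rw [fderiv_phaseMul_apply_single hθ hΦ, norm_mul, Complex.norm_exp_ofReal_mul_I, one_mul,
      norm_sub_I_mul_sq, particleCurrent]
    ring
  unfold kineticDensityReal
  simp only [hik, Finset.sum_add_distrib, Finset.sum_sub_distrib, Finset.mul_sum]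

/-! ### The gain functional and the admissible phases -/

/-- **The phase-unwinding gain** `GAIN(θ; Φ) = 2 ∫_{[0,L)³} ∇θ·j_Φ dx - ∫_{[0,L)³} |∇θ|² n_Φ dx` of a real
one-body phase `θ` on the (unnormalised) `N`-body function `Φ`: the kinetic energy removed by the
configuration-space unitary `U_θ = e^{-i∑ⱼθ(xⱼ)}`, `T(U_θΦ) = T(Φ) - GAIN(θ; Φ)`
(`cellKineticEnergy_phaseMul`; the interaction and all densities are unchanged). Gradients are
written in the coordinates `∂ₖθ = dθ(eₖ)`. [cite: LSSY2005, §5.2 (5.19)–(5.23)] -/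
def phaseGain (L : ℝ) (N : ℕ) (Φ : Config N → ℂ) (θ : Space → ℝ) : ℝ :=
  2 * (∫ x in cell L, ∑ k : Fin 3, fderiv ℝ θ x (EuclideanSpace.single k 1) * oneBodyCurrent L N Φ k x) -
    ∫ x in cell L, (∑ k : Fin 3, fderiv ℝ θ x (EuclideanSpace.single k 1) ^ 2) * oneBodyDensity L N Φ x

/-- **Admissible phases**: `θ : ℝ³ → ℝ` of class `C¹` and `Lℤ³`-periodic (on the generators `L eₖ`),
so that `U_θ` maps periodic `C¹` states to periodic `C¹` states (`PeriodicTrialState.phaseMul`).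
[cite: LSSY2005, §5.2 (5.23)–(5.24)] -/
structure IsPeriodicPhase (L : ℝ) (θ : Space → ℝ) : Prop where
  /-- `θ` is `C¹`. -/
  contDiff : ContDiff ℝ 1 θ
  /-- `θ(x + L eₖ) = θ(x)`. -/
  periodic : ∀ (x : Space) (k : Fin 3), θ (x + EuclideanSpace.single k L) = θ x

/-- **The maximal phase-unwinding gain** `GAIN*(Φ) = sup_θ GAIN(θ; Φ) ∈ [0, ∞]` over admissible
(`C¹`, periodic) phases: the largest kinetic energy a configuration-space phase unitary can remove
from `Φ`. Formally `GAIN* = ∫ |P_∇ j_Φ|²/n_Φ`, the `n_Φ`-weighted `Ḣ⁻¹`-type norm of the current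
(the supremum of `2⟨∇θ, j⟩ - ⟨∇θ, n∇θ⟩` is attained at the weighted Helmholtz projection of `j_Φ`
onto periodic gradients); here it is *defined* by the variational formula, each term truncated at `0`
by `ENNReal.ofReal` (harmless: `θ = const` contributes `0`, `phaseGain_const`). [folklore] -/
def maxPhaseGain (L : ℝ) (N : ℕ) (Φ : Config N → ℂ) : ℝ≥0∞ :=
  ⨆ (θ : Space → ℝ) (_ : IsPeriodicPhase L θ), ENNReal.ofReal (phaseGain L N Φ θ)

namespace IsPeriodicPhase

variable {L : ℝ} {θ η : Space → ℝ}

/-- Constants are admissible phases. [folklore] -/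
theorem const (L c : ℝ) : IsPeriodicPhase L fun _ : Space => c :=
  ⟨contDiff_const, fun _ _ => rfl⟩

/-- Admissible phases are continuous. [folklore] -/
theorem continuous (h : IsPeriodicPhase L θ) : Continuous θ := h.contDiff.continuous

/-- Admissible phases are differentiable. [folklore] -/
theorem differentiable (h : IsPeriodicPhase L θ) : Differentiable ℝ θ :=
  h.contDiff.differentiable one_ne_zero

/-- Sums of admissible phases are admissible. [folklore] -/
theorem add (hθ : IsPeriodicPhase L θ) (hη : IsPeriodicPhase L η) : IsPeriodicPhase L (θ + η) :=
  ⟨hθ.contDiff.add hη.contDiff, fun x k => by simp only [Pi.add_apply, hθ.periodic, hη.periodic]⟩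

/-- Scalar multiples of admissible phases are admissible. [folklore] -/
theorem smul (c : ℝ) (hθ : IsPeriodicPhase L θ) : IsPeriodicPhase L (c • θ) :=
  ⟨contDiff_const.smul hθ.contDiff, fun x k => by simp only [Pi.smul_apply, hθ.periodic]⟩

/-- Negatives of admissible phases are admissible (`U_{-θ} = U_θ^*`). [folklore] -/
theorem neg (hθ : IsPeriodicPhase L θ) : IsPeriodicPhase L (-θ) :=
  ⟨hθ.contDiff.neg, fun x k => by simp only [Pi.neg_apply, hθ.periodic]⟩

end IsPeriodicPhase

/-- A constant phase (a global `U(1)` rotation) gains nothing: `GAIN(c; Φ) = 0`. [folklore] -/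
@[simp]
theorem phaseGain_const (L : ℝ) (N : ℕ) (Φ : Config N → ℂ) (c : ℝ) :
    phaseGain L N Φ (fun _ => c) = 0 := by
  simp [phaseGain]

/-- The variational lower bound: every admissible phase gives `GAIN(θ; Φ) ≤ GAIN*(Φ)`. [folklore] -/
theorem le_maxPhaseGain (L : ℝ) (N : ℕ) (Φ : Config N → ℂ) {θ : Space → ℝ}
    (hθ : IsPeriodicPhase L θ) : ENNReal.ofReal (phaseGain L N Φ θ) ≤ maxPhaseGain L N Φ := by
  unfold maxPhaseGain
  exact le_iSup₂ (f := fun (θ : Space → ℝ) (_ : IsPeriodicPhase L θ) =>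
    ENNReal.ofReal (phaseGain L N Φ θ)) θ hθ

/-- For `C ≥ 0`: `GAIN*(Φ) ≤ C` iff `GAIN(θ; Φ) ≤ C` for every admissible phase. [folklore] -/
theorem maxPhaseGain_le_ofReal_iff {L : ℝ} {N : ℕ} {Φ : Config N → ℂ} {C : ℝ} (hC : 0 ≤ C) :
    maxPhaseGain L N Φ ≤ ENNReal.ofReal C ↔
      ∀ θ : Space → ℝ, IsPeriodicPhase L θ → phaseGain L N Φ θ ≤ C := by
  unfold maxPhaseGain
  rw [iSup₂_le_iff]
  refine forall₂_congr fun θ _ => ?_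
  rw [ENNReal.ofReal_le_ofReal_iff hC]

/-! ### Integrating out all particles but one (Fubini on the cell) -/

section Marginal

variable {n : ℕ} {L : ℝ}

/-- `dX|_{cell^N}` is the product of the `dx|_{cell}` (restatement of `Measure.restrict_pi_pi`;
private, also available as `volume_restrict_cellN` in `PeriodicBoseGasThm31.lean`). [folklore] -/
private theorem volume_restrict_cellN_pi (N : ℕ) (L : ℝ) :
    (volume : Measure (Config N)).restrict (cellN N L) =
      Measure.pi fun _ : Fin N => (volume : Measure Space).restrict (cell L) := by
  have h : cellN N L = Set.univ.pi fun _ : Fin N => cell L := by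
    ext X; simp [cellN]
  rw [h, volume_pi, Measure.restrict_pi_pi]

/-- Splitting off the `i`-th particle, `X ↦ (xᵢ, X̂ᵢ)`, carries `dX|_{cell^{n+1}}` to
`dx|_{cell} ⊗ dY|_{cell^n}`. [folklore] -/
theorem measurePreserving_piFinSuccAbove_cellN (i : Fin (n + 1)) (L : ℝ) :
    MeasurePreserving (MeasurableEquiv.piFinSuccAbove (fun _ => Space) i)
      ((volume : Measure (Config (n + 1))).restrict (cellN (n + 1) L))
      (((volume : Measure Space).restrict (cell L)).prod
        ((volume : Measure (Config n)).restrict (cellN n L))) := by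
  rw [volume_restrict_cellN_pi, volume_restrict_cellN_pi]
  exact measurePreserving_piFinSuccAbove (fun _ => (volume : Measure Space).restrict (cell L)) i

/-- Transport of integrability to the split coordinates `(xᵢ, X̂ᵢ)` for a continuous integrand of
the form `g(xᵢ) F(X)` (private bookkeeping). [folklore] -/
private theorem integrable_split (i : Fin (n + 1)) {g : Space → ℝ} (hg : Continuous g)
    {F : Config (n + 1) → ℝ} (hF : Continuous F) :
    Integrable (fun p : Space × Config n =>
        g (((MeasurableEquiv.piFinSuccAbove (fun _ => Space) i).symm p) i) *
          F ((MeasurableEquiv.piFinSuccAbove (fun _ => Space) i).symm p))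
      (((volume : Measure Space).restrict (cell L)).prod
        ((volume : Measure (Config n)).restrict (cellN n L))) := by
  set e := MeasurableEquiv.piFinSuccAbove (fun _ : Fin (n + 1) => Space) i
  have he := (measurePreserving_piFinSuccAbove_cellN (n := n) i L).symm e
  exact (he.integrable_comp_emb e.symm.measurableEmbedding (g := fun X => g (X i) * F X)).mpr
    (integrableOn_cellN ((hg.comp (continuous_apply i)).mul hF) L)

/-- **Integrating out all particles but the `i`-th** (Fubini on `cell^{n+1} ≅ cell × cell^n` at
slot `i`): for continuous `g` and `F`,
`∫_{[0,L)^{3(n+1)}} g(xᵢ) F(X) dX = ∫_{[0,L)³} g(x) (∫_{[0,L)^{3n}} F(X; xᵢ = x) dX̂ᵢ) dx`.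
[folklore] -/
theorem integral_cellN_mul_eq_integral_marginal (i : Fin (n + 1)) {g : Space → ℝ}
    (hg : Continuous g) {F : Config (n + 1) → ℝ} (hF : Continuous F) :
    ∫ X in cellN (n + 1) L, g (X i) * F X =
      ∫ x in cell L, g x * ∫ Y in cellN n L, F (i.insertNth x Y) := by
  set e := MeasurableEquiv.piFinSuccAbove (fun _ : Fin (n + 1) => Space) i with he_def
  have he := (measurePreserving_piFinSuccAbove_cellN (n := n) i L).symm e
  have hes : ∀ (x : Space) (Y : Config n), e.symm (x, Y) = i.insertNth x Y := fun _ _ => rfl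
  calc ∫ X in cellN (n + 1) L, g (X i) * F X
      = ∫ p, g ((e.symm p) i) * F (e.symm p) ∂(((volume : Measure Space).restrict (cell L)).prod
          ((volume : Measure (Config n)).restrict (cellN n L))) :=
        (he.integral_comp' (fun X => g (X i) * F X)).symm
    _ = ∫ x in cell L, ∫ Y in cellN n L, g ((e.symm (x, Y)) i) * F (e.symm (x, Y)) :=
        integral_prod _ (integrable_split i hg hF)
    _ = ∫ x in cell L, g x * ∫ Y in cellN n L, F (i.insertNth x Y) := by
        refine integral_congr_ae (Filter.Eventually.of_forall fun x => ?_)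
        simp only [hes, Fin.insertNth_apply_same]
        exact integral_const_mul _ _

/-- The weighted marginal `x ↦ g(x) ∫_{cell^n} F(X; xᵢ = x) dX̂ᵢ` is integrable on the cell for
continuous `g`, `F`. [folklore] -/
theorem integrableOn_mul_marginal (i : Fin (n + 1)) {g : Space → ℝ} (hg : Continuous g)
    {F : Config (n + 1) → ℝ} (hF : Continuous F) :
    IntegrableOn (fun x => g x * ∫ Y in cellN n L, F (i.insertNth x Y)) (cell L) volume := by
  set e := MeasurableEquiv.piFinSuccAbove (fun _ : Fin (n + 1) => Space) i with he_def
  have hes : ∀ (x : Space) (Y : Config n), e.symm (x, Y) = i.insertNth x Y := fun _ _ => rfl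
  have h := (integrable_split (L := L) i hg hF).integral_prod_left
  refine h.congr (Filter.Eventually.of_forall fun x => ?_)
  simp only [← he_def, hes, Fin.insertNth_apply_same]
  exact integral_const_mul _ _

end Marginal

/-! ### The gain identity -/

section GainIdentity

variable {L : ℝ} {θ : Space → ℝ} {Φ : Config N → ℂ}

/-- `∂ₖθ` is continuous for `θ ∈ C¹`. [folklore] -/
theorem continuous_fderiv_apply_single {θ : Space → ℝ} (hθ : ContDiff ℝ 1 θ) (k : Fin 3) :
    Continuous fun x => fderiv ℝ θ x (EuclideanSpace.single k 1) :=
  (hθ.continuous_fderiv one_ne_zero).clm_apply continuous_const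

/-- `J_{i,k} = Im(conj Φ ∂_{i,k}Φ)` is continuous for `Φ ∈ C¹`. [folklore] -/
theorem continuous_particleCurrent {Φ : Config N → ℂ} (hΦ : ContDiff ℝ 1 Φ) (i : Fin N) (k : Fin 3) :
    Continuous (particleCurrent i k Φ) := by
  unfold particleCurrent
  exact Complex.continuous_im.comp ((Complex.continuous_conj.comp hΦ.continuous).mul
    ((hΦ.continuous_fderiv one_ne_zero).clm_apply continuous_const))

/-- The current pairing in configuration space equals its one-body form:
`∫_{cell^N} ∑ᵢ ∇θ(xᵢ)·Jᵢ(X) dX = ∫_{cell} ∇θ·j_Φ dx`. [folklore] -/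
theorem integral_sum_fderiv_mul_particleCurrent (hθ : ContDiff ℝ 1 θ) :
    ∀ {N : ℕ} {Φ : Config N → ℂ}, ContDiff ℝ 1 Φ →
      ∫ X in cellN N L, ∑ i : Fin N, ∑ k : Fin 3,
          fderiv ℝ θ (X i) (EuclideanSpace.single k 1) * particleCurrent i k Φ X =
        ∫ x in cell L, ∑ k : Fin 3,
          fderiv ℝ θ x (EuclideanSpace.single k 1) * oneBodyCurrent L N Φ k x
  | 0, Φ, _ => by simp [oneBodyCurrent]
  | n + 1, Φ, hΦ => by
    have hθ' := continuous_fderiv_apply_single hθ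
    have hJ := continuous_particleCurrent hΦ
    -- configuration side: pull the sums out and integrate out the other particles
    have hint : ∀ (i : Fin (n + 1)) (k : Fin 3), Integrable (fun X : Config (n + 1) =>
        fderiv ℝ θ (X i) (EuclideanSpace.single k 1) * particleCurrent i k Φ X)
        ((volume : Measure (Config (n + 1))).restrict (cellN (n + 1) L)) := fun i k =>
      integrableOn_cellN (((hθ' k).comp (continuous_apply i)).mul (hJ i k)) L
    rw [integral_finsetSum _ fun i _ => integrable_finsetSum _ fun k _ => hint i k]
    simp_rw [integral_finsetSum _ fun k _ => hint _ k,
      integral_cellN_mul_eq_integral_marginal _ (hθ' _) (hJ _ _)]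
    -- one-body side
    have hint' : ∀ (i : Fin (n + 1)) (k : Fin 3), Integrable (fun x : Space =>
        fderiv ℝ θ x (EuclideanSpace.single k 1) *
          ∫ Y in cellN n L, particleCurrent i k Φ (i.insertNth x Y))
        ((volume : Measure Space).restrict (cell L)) := fun i k =>
      integrableOn_mul_marginal i (hθ' k) (hJ i k)
    have hrhs : (fun x : Space => ∑ k : Fin 3, fderiv ℝ θ x (EuclideanSpace.single k 1) *
        oneBodyCurrent L (n + 1) Φ k x) = fun x => ∑ k : Fin 3, ∑ i : Fin (n + 1),
          fderiv ℝ θ x (EuclideanSpace.single k 1) *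
            ∫ Y in cellN n L, particleCurrent i k Φ (i.insertNth x Y) := by
      funext x
      simp only [oneBodyCurrent, Finset.mul_sum]
    rw [hrhs, integral_finsetSum _ fun k _ => integrable_finsetSum _ fun i _ => hint' i k]
    simp_rw [integral_finsetSum _ fun i _ => hint' i _]
    exact Finset.sum_comm

/-- The density pairing in configuration space equals its one-body form:
`∫_{cell^N} ∑ᵢ |∇θ(xᵢ)|² |Φ(X)|² dX = ∫_{cell} |∇θ|² n_Φ dx`. [folklore] -/
theorem integral_sum_fderiv_sq_mul_norm_sq (hθ : ContDiff ℝ 1 θ) :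
    ∀ {N : ℕ} {Φ : Config N → ℂ}, ContDiff ℝ 1 Φ →
      ∫ X in cellN N L, ∑ i : Fin N, ∑ k : Fin 3,
          fderiv ℝ θ (X i) (EuclideanSpace.single k 1) ^ 2 * ‖Φ X‖ ^ 2 =
        ∫ x in cell L, (∑ k : Fin 3, fderiv ℝ θ x (EuclideanSpace.single k 1) ^ 2) *
          oneBodyDensity L N Φ x
  | 0, Φ, _ => by simp [oneBodyDensity]
  | n + 1, Φ, hΦ => by
    have hθ' : ∀ k : Fin 3, Continuous fun x => fderiv ℝ θ x (EuclideanSpace.single k 1) ^ 2 :=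
      fun k => (continuous_fderiv_apply_single hθ k).pow 2
    have hF : Continuous fun X : Config (n + 1) => ‖Φ X‖ ^ 2 := (hΦ.continuous.norm).pow 2
    have hint : ∀ (i : Fin (n + 1)) (k : Fin 3), Integrable (fun X : Config (n + 1) =>
        fderiv ℝ θ (X i) (EuclideanSpace.single k 1) ^ 2 * ‖Φ X‖ ^ 2)
        ((volume : Measure (Config (n + 1))).restrict (cellN (n + 1) L)) := fun i k =>
      integrableOn_cellN (((hθ' k).comp (continuous_apply i)).mul hF) L
    rw [integral_finsetSum _ fun i _ => integrable_finsetSum _ fun k _ => hint i k]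
    simp_rw [integral_finsetSum _ fun k _ => hint _ k]
    have hmarg : ∀ (i : Fin (n + 1)) (k : Fin 3),
        ∫ X in cellN (n + 1) L, fderiv ℝ θ (X i) (EuclideanSpace.single k 1) ^ 2 * ‖Φ X‖ ^ 2 =
          ∫ x in cell L, fderiv ℝ θ x (EuclideanSpace.single k 1) ^ 2 *
            ∫ Y in cellN n L, ‖Φ (i.insertNth x Y)‖ ^ 2 := fun i k =>
      integral_cellN_mul_eq_integral_marginal i (hθ' k) hF
    simp_rw [hmarg]
    have hint' : ∀ (i : Fin (n + 1)) (k : Fin 3), Integrable (fun x : Space =>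
        fderiv ℝ θ x (EuclideanSpace.single k 1) ^ 2 * ∫ Y in cellN n L, ‖Φ (i.insertNth x Y)‖ ^ 2)
        ((volume : Measure Space).restrict (cell L)) := fun i k =>
      integrableOn_mul_marginal i (hθ' k) hF
    have hrhs : (fun x : Space => (∑ k : Fin 3, fderiv ℝ θ x (EuclideanSpace.single k 1) ^ 2) *
        oneBodyDensity L (n + 1) Φ x) = fun x => ∑ k : Fin 3, ∑ i : Fin (n + 1),
          fderiv ℝ θ x (EuclideanSpace.single k 1) ^ 2 *
            ∫ Y in cellN n L, ‖Φ (i.insertNth x Y)‖ ^ 2 := by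
      funext x
      simp only [oneBodyDensity]
      exact Finset.sum_mul_sum _ _ _ _
    rw [hrhs, integral_finsetSum _ fun k _ => integrable_finsetSum _ fun i _ => hint' i k]
    simp_rw [integral_finsetSum _ fun i _ => hint' i _]
    exact Finset.sum_comm

/-- **The gain identity** (the kinetic energy of a gauge-transformed `N`-body function):
for `θ, Φ ∈ C¹`, `T_L(e^{-i∑ⱼθ(xⱼ)}Φ) = T_L(Φ) - 2∫_{cell}∇θ·j_Φ + ∫_{cell}|∇θ|²n_Φ = T_L(Φ) - GAIN(θ; Φ)`
(`U_θ^*(∑ⱼ -Δⱼ)U_θ = ∑ⱼ (pⱼ - ∇θ(xⱼ))²` in expectation; the interaction is unchanged since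
`|U_θΦ| = |Φ|`). [cite: LSSY2005, §5.2 (5.19)–(5.23)] -/
theorem cellKineticEnergy_phaseMul (hθ : ContDiff ℝ 1 θ) (hΦ : ContDiff ℝ 1 Φ) (L : ℝ) :
    cellKineticEnergy L (phaseMul θ Φ) = cellKineticEnergy L Φ - phaseGain L N Φ θ := by
  have hpt : ∀ X : Config N, kineticDensityReal (phaseMul θ Φ) X =
      kineticDensityReal Φ X -
        2 * ∑ i : Fin N, ∑ k : Fin 3,
          fderiv ℝ θ (X i) (EuclideanSpace.single k 1) * particleCurrent i k Φ X +
        ∑ i : Fin N, ∑ k : Fin 3, fderiv ℝ θ (X i) (EuclideanSpace.single k 1) ^ 2 * ‖Φ X‖ ^ 2 :=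
    fun X => kineticDensityReal_phaseMul (hθ.differentiable one_ne_zero)
      ((hΦ.differentiable one_ne_zero) X)
  have hθ' := continuous_fderiv_apply_single hθ
  have h1 : Integrable (kineticDensityReal Φ) ((volume : Measure (Config N)).restrict (cellN N L)) :=
    integrableOn_cellN (continuous_kineticDensityReal hΦ) L
  have h2 : Integrable (fun X : Config N => 2 * ∑ i : Fin N, ∑ k : Fin 3,
      fderiv ℝ θ (X i) (EuclideanSpace.single k 1) * particleCurrent i k Φ X)
      ((volume : Measure (Config N)).restrict (cellN N L)) :=
    (integrableOn_cellN (continuous_finsetSum _ fun i _ => continuous_finsetSum _ fun k _ =>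
      ((hθ' k).comp (continuous_apply i)).mul (continuous_particleCurrent hΦ i k)) L).const_mul 2
  have h3 : Integrable (fun X : Config N => ∑ i : Fin N, ∑ k : Fin 3,
      fderiv ℝ θ (X i) (EuclideanSpace.single k 1) ^ 2 * ‖Φ X‖ ^ 2)
      ((volume : Measure (Config N)).restrict (cellN N L)) :=
    integrableOn_cellN (continuous_finsetSum _ fun i _ => continuous_finsetSum _ fun k _ =>
      (((hθ' k).comp (continuous_apply i)).pow 2).mul ((hΦ.continuous.norm).pow 2)) L
  have h12 : Integrable (fun X : Config N => kineticDensityReal Φ X - 2 * ∑ i : Fin N, ∑ k : Fin 3,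
      fderiv ℝ θ (X i) (EuclideanSpace.single k 1) * particleCurrent i k Φ X)
      ((volume : Measure (Config N)).restrict (cellN N L)) := h1.sub h2
  unfold cellKineticEnergy phaseGain
  simp_rw [hpt]
  rw [integral_add h12 h3, integral_sub h1 h2, integral_const_mul,
    integral_sum_fderiv_mul_particleCurrent hθ hΦ, integral_sum_fderiv_sq_mul_norm_sq hθ hΦ]
  ring

/-- The gain as an energy difference: `GAIN(θ; Φ) = T_L(Φ) - T_L(U_θΦ)`. [cite: LSSY2005, §5.2 (5.19)–(5.23)] -/
theorem phaseGain_eq_sub (hθ : ContDiff ℝ 1 θ) (hΦ : ContDiff ℝ 1 Φ) (L : ℝ) :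
    phaseGain L N Φ θ = cellKineticEnergy L Φ - cellKineticEnergy L (phaseMul θ Φ) := by
  rw [cellKineticEnergy_phaseMul hθ hΦ]
  ring

/-- `GAIN(θ; Φ) ≤ T_L(Φ)`: a phase unitary cannot remove more than the kinetic energy. [folklore] -/
theorem phaseGain_le_cellKineticEnergy (hθ : ContDiff ℝ 1 θ) (hΦ : ContDiff ℝ 1 Φ) (L : ℝ) :
    phaseGain L N Φ θ ≤ cellKineticEnergy L Φ := by
  rw [phaseGain_eq_sub hθ hΦ]
  linarith [cellKineticEnergy_nonneg L (phaseMul θ Φ)]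

/-- `GAIN*(Φ) ≤ T_L(Φ) < ∞` for `Φ ∈ C¹`. [folklore] -/
theorem maxPhaseGain_le_cellKineticEnergy (hΦ : ContDiff ℝ 1 Φ) (L : ℝ) :
    maxPhaseGain L N Φ ≤ ENNReal.ofReal (cellKineticEnergy L Φ) :=
  (maxPhaseGain_le_ofReal_iff (cellKineticEnergy_nonneg L Φ)).mpr fun _ hθ =>
    phaseGain_le_cellKineticEnergy hθ.contDiff hΦ L

/-- **The energy of the unwound state**: for `θ, Φ ∈ C¹`,
`⟨U_θΦ, H U_θΦ⟩ = (T_L(Φ) - GAIN(θ; Φ)) + ∫_{cell} ∑_{i<j} v^per(xᵢ - xⱼ)|Φ|²` — the interaction term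
of `U_θΦ` is that of `Φ`. [cite: LSSY2005, §5.2 (5.19)–(5.23)] -/
theorem periodicForm_phaseMul (v : ℝ → ℝ≥0∞) (hθ : ContDiff ℝ 1 θ) (hΦ : ContDiff ℝ 1 Φ) (L : ℝ) :
    periodicForm v L (phaseMul θ Φ) =
      ENNReal.ofReal (cellKineticEnergy L Φ - phaseGain L N Φ θ) +
        ∫⁻ X in cellN N L, periodicInteraction v L X * (‖Φ X‖₊ : ℝ≥0∞) ^ 2 := by
  have hm : Measurable (kineticDensity (phaseMul θ Φ)) := by
    have h : kineticDensity (phaseMul θ Φ) = fun X => ENNReal.ofReal (kineticDensityReal (phaseMul θ Φ) X) :=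
      funext fun X => kineticDensity_eq_ofReal _ X
    rw [h]
    exact (continuous_kineticDensityReal (contDiff_phaseMul hθ hΦ)).measurable.ennreal_ofReal
  rw [periodicForm, lintegral_add_left hm, lintegral_kineticDensity_eq (contDiff_phaseMul hθ hΦ),
    cellKineticEnergy_phaseMul hθ hΦ]
  simp_rw [nnnorm_phaseMul]

end GainIdentity

end Literature.MathematicalPhysics.QuantumManyBody.BoseGas
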